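import Literature.NumberTheory.EllipticCurves.Sprung2024.ChromaticSmallControlSurjProofs
import Literature.NumberTheory.EllipticCurves.Sprung2012.ColemanMapLambdaActionProofs
import HarnessLib

/-!
# Crux K1 `SprungLowerDivisibilityAtThree` (stmt-BirchSwinnertonDyer-19875), line `chromatic-common-zeros`,
# stub S4b at the FIRST cyclotomic prime, LOCAL/KUMMER SIDE:
# `Ker Col♯` kills the first local layer `E(K_1·K_v)`, so the Kummer classes of `E(K_1)` land in `Sel♯(E/K_∞)`
# (`--supports` 19875 as helper; closes nothing by itself)

The registered stub S4b (`ChromaticCommonZeros.stub_cyclotomicLowerRest`, skeleton v6 of the lead) asks,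
at a height-one prime `𝔭 ∋ ω_n` of `Λ = ℤ_p⟦T⟧` other than `(T)` (at `r_an ≤ 1`) that is a common zero of
both normalised chromatic `p`-adic `L`-functions, for the Eisenstein inequality
`ℓ_𝔭 Λ/(G^•) ≤ ℓ_𝔭 X^•(E/ℚ_∞)`. At the FIRST such prime, `𝔭 = (ξ_p)`, `ξ_p = Φ_p(1+T)` (`ω_1 = T·ξ_p`),
the right-hand side is fed by RANK GROWTH in the first layer `K_1` of the cyclotomic tower (Greenberg, LNM
1716, §5 p. 132 for the classical Selmer group; tree `Rank1Residual/Iwasawa/RankGrowthCyclotomicFactor`). For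
Sprung's ♯/♭ Selmer groups the one new input is LOCAL: a Kummer class of a point of `E(K_1)` must satisfy
the `•`-condition at `𝔭 ∣ p`, i.e. every `z ∈ Ker Col^•` must kill the FIRST layer `E(K_1·K_v)` of the local
tower. This file proves that for `• = ♯` (in the tree's transcription `Sprung2012.IsColemanPair`,
`Sprung2017.chromaticL`):

* §1 `colemanKer_sharp_apply_eq_zero_of_mem_localLayerPointsOfEmb_one` — **`Ker Col♯` kills
  `E(K_1·K_v)`**: the level-`1` clause of the Coleman characterisation (Sprung 2012 Def. 5.9 / 7.1–7.2,
  `ω_1 ∣ P_{1,c_1}(z) + u_1 L♯ + v_1 L♭` with `u_1 = 1`, `v_1 = 0`, Sprung 2017 Cor. 4.4) gives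
  `ω_1 ∣ P_{1,c_1}(z)` when `L♯ = 0`; the bottom layer is already killed (tree theorem
  `colemanKer_apply_eq_zero_of_mem_localLayerPointsOfEmb_zero`, which uses `p ≠ 2`, `p ∣ a_p`), so
  `P_{1,c_0}(z|_{E(K_1·K_v)}) = 0`; the generation clause of Thm. 2.2 at level `1` ("`F_ss(𝔪_1)` is generated
  by `c_1` and `c_0`", dual form in `IsHondaSystem`) forces `z|_{E(K_1·K_v)} = 0`. (For `• = ♭` the level-`2`
  clause reads `P_{2,c_2}(z) ≡ −a_p L♯`, so at `a_p ≠ 0` — class X8 — the flat colour does NOT read the first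
  layer; at `a_p = 0` this is Kobayashi's `E⁺/E⁻` parity, Invent. Math. 152 (2003) Def. 1.1 / Prop. 8.12.)
* §2 `layerToInfty_mem_sharpFlatSelmerInfty_of_mem_selmerLayer` — **the layer-`n` control map lands in
  `Sel^•(E/K_∞)`** provided `Ker Col^•` kills `E(K_n·K_v)`: verbatim the tree's layer-`0` theorem
  `Sprung2024.layerToInfty_mem_sharpFlatSelmerInfty_of_mem_selmerLayer_zero` with `0 ↦ n` (classical part
  `map_layerToInfty_selmerLayer_le_holds`; the `•`-condition at `𝔭` and its conjugates from the local Kummer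
  sequence `Kobayashi2003.localKerOverOfEmb_le_localKummerOverOfEmb_fixedPoints`).
* §3 `rat_layerToInfty_one_mem_sharpSelmerInfty` — over `ℚ` at `n = 1`, `• = ♯`, the hypothesis of §2
  DISCHARGED by §1 in the binder telescope of the crux (`p ≠ 2`, `p ∣ a_p`, Honda system):
  `h_1(Sel_{p^∞}(E/ℚ_1)) ⊆ Sel♯(E/ℚ_∞)`.

The sequel `…CyclotomicLowerAtXiRankGrowth.lean` composes §2 with the layer Kummer map
`θ_1 = LayerKummer.kummerLayerToInfty` (Greenberg's `s_1 ∘ κ`, `p^a`-bounded kernel) and turns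
`rank E(K) + (p−1)·t ≤ rank E(K_1)` into `t ≤ ℓ_{(ξ_p)} X♯(E/K_∞)` (character argument) and into S4b's
inequality at `(ξ_3)` for both colours.
No reduction hypothesis beyond the displayed ones; no named fact; no control theorem; K1, Sprung's main
conjecture and BSD on leaf X8 are NOT proved by this file.

References: [Sprung2012] F. Sprung, J. Number Theory 132 (2012), Thm. 2.2 (p. 1487), Def. 3.1 (p. 1489),
Def. 5.9 (p. 1495), Def. 7.1–7.2 (p. 1500), Def. 7.9 / 7.11 (p. 1503); [Sprung2017] F. Sprung, ANT 11
(2017), Cor. 4.4; [Sprung2024] F. Sprung, Adv. Math. 449 (2024), §5.2 p. 39; [Kobayashi2003] S. Kobayashi,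
Invent. Math. 152 (2003), Def. 1.1, Prop. 8.12, Thm. 9.3; [GreenbergLNM1716] R. Greenberg, LNM 1716 (1999),
§2 p. 72, §3 Lemma 3.1 (p. 86), §5 p. 132.
-/

set_option autoImplicit false
-- justification: the mandated namespace `Summit.BirchSwinnertonDyer.BirchSwinnertonDyer.Theorems`
-- (single-conjunct summit, Sub = Summit) repeats a segment by design (D-0017).
set_option linter.dupNamespace false

noncomputable section

open CategoryTheory Literature.NumberTheory.EllipticCurves Literature.NumberTheory.GaloisRepresentations
  Literature.NumberTheory.EllipticCurves.ResKernel Literature.NumberTheory.EllipticCurves.IwasawaAlgebra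
  Literature.NumberTheory.EllipticCurves.Sprung2017 Literature.NumberTheory.EllipticCurves.Sprung2012
  Literature.NumberTheory.EllipticCurves.Sprung2024 Literature.NumberTheory.EllipticCurves.Kobayashi2003
  WeierstrassCurve ZpExtension NumberField IsDedekindDomain Polynomial

open scoped Classical NumberField

universe u

namespace Summit.BirchSwinnertonDyer.BirchSwinnertonDyer.Theorems.ChromaticCommonZeros

/-! ## §1. `Ker Col♯` kills the first local layer `E(K_1·K_v)` -/

section Local

variable {K : Type u} [Field K] {p : ℕ} [Fact p.Prime] (κ : ZpExtension K p)
variable {E : Type u} [Field E] [Algebra K E] (ι : AlgebraicClosure K →ₐ[K] AlgebraicClosure E)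
variable (W : WeierstrassCurve K)

/-- **`Ker Col♯` kills the first layer `E(K_1·K_v)` of the local tower.** For `p ≠ 2`, `p ∣ a_p`, a
local lift `g` of a topological generator, a Honda system `(cneg, c)` (Sprung 2012 Thm. 2.2) and
`z ∈ Ker Col♯` (`colemanKer … Chroma.sharp`: `z` has a Coleman value `(L♯, L♭)` with `L♯ = 0`), the
functional `z` on `E(K_∞·K_v)` vanishes on `E(K_1·K_v)`. Proof: level `1` of the Coleman
characterisation (`IsColemanPair`, Def. 5.9 / 7.1–7.2 with `u_1 = 1`, `v_1 = 0`, Sprung 2017 Cor. 4.4)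
reads `ω_1 ∣ P_{1,c_1}(z) + L♯`, so `ω_1 ∣ P_{1,c_1}(z)`; the orbit of `c_0 ∈ E(K_v)` is killed by `z`
(tree theorem `colemanKer_apply_eq_zero_of_mem_localLayerPointsOfEmb_zero`), so `P_{1,c_0}(z) = 0` on
the layer; the generation clause of Thm. 2.2 at level `1` (dual form: a functional on `E(K_1·K_v)` with
`P_{1,c_1} ≡ P_{1,c_0} ≡ 0 (mod ω_1)` is `0`) gives `z|_{E(K_1·K_v)} = 0`. This is the inclusion
`E(K_{1,𝔭}) ⊗ ℚ_p/ℤ_p ⊆ E♯_{1,𝔭}` (the exact annihilator of `Ker Col♯`, Def. 7.9), the level-`1`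
companion of Sprung 2024 p. 39 "`E♯_{0,p} = E♭_{0,p} = E(ℚ_p) ⊗ ℚ_p/ℤ_p`"; at `a_p = 0` it is
Kobayashi's `Ê(𝔪_1) ⊆ E⁻(k_1)`-type statement (Def. 1.1, Prop. 8.12).
[cite: Sprung2012, Def. 5.9 (p. 1495), Def. 7.1–7.2 (p. 1500), Def. 7.9 (p. 1503), Thm. 2.2 (p. 1487)]
[cite: Sprung2017, §4 Cor. 4.4] [cite: Sprung2024, §5.2 p. 39] [cite: Kobayashi2003, Def. 1.1 and Prop. 8.12] -/
theorem colemanKer_sharp_apply_eq_zero_of_mem_localLayerPointsOfEmb_one {ap : ℤ} (hp2 : p ≠ 2)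
    (hap : (p : ℤ) ∣ ap) {g : Field.absoluteGaloisGroup E} (hg : κ.IsTopGenerator (resGalOfEmb ι g))
    {cneg : localPoints W E} {c : ℕ → localPoints W E} (hH : IsHondaSystem κ ι W ap g cneg c)
    {z : localTowerPointsOfEmb κ ι W →+ ℤ_[p]} (hz : z ∈ colemanKer κ ι W ap g c Chroma.sharp)
    {x : localPoints W E} (hx : x ∈ localLayerPointsOfEmb κ ι W 1) :
    z ⟨x, localLayerPointsOfEmb_le_localTowerPointsOfEmb κ ι W 1 hx⟩ = 0 := by
  have hle := fun n ↦ localLayerPointsOfEmb_le_localTowerPointsOfEmb κ ι W n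
  -- the bottom layer is killed (tree theorem, uses `p ≠ 2`, `p ∣ a_p`)
  have h0 : ∀ (y : localPoints W E) (hy : y ∈ localLayerPointsOfEmb κ ι W 0),
      z ⟨y, hle 0 hy⟩ = 0 := fun y hy ↦
    colemanKer_apply_eq_zero_of_mem_localLayerPointsOfEmb_zero κ ι W hp2 hap hg hH Chroma.sharp hz hy
  obtain ⟨-, hc, -, -, -, -, -, hgen1, -⟩ := hH
  obtain ⟨Ls, Lf, hCP, hcol⟩ := hz
  rw [chromaticL_sharp] at hcol
  -- the restriction of `z` to the first layer
  let z₁ : localLayerPointsOfEmb κ ι W 1 →+ ℤ_[p] := z.comp (AddSubgroup.inclusion (hle 1))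
  have hz₁ : ∀ (y : localPoints W E) (hy : y ∈ localLayerPointsOfEmb κ ι W 1),
      z₁ ⟨y, hy⟩ = z ⟨y, hle 1 hy⟩ := fun _ _ ↦ rfl
  -- level `1` of the Coleman characterisation: `ω_1 ∣ P_{1,c_1}(z)`
  have hmem1 : ∀ j : ℕ, g ^ j • c 1 ∈ localLayerPointsOfEmb κ ι W 1 := fun j ↦
    smul_mem_localLayerPointsOfEmb κ ι W 1 _ (hc 1)
  have hP1 : toIwasawa p (cyclotomicOmega p 1) ∣
      pairingSum W (localLayerPointsOfEmb κ ι W 1) g 1 (c 1) z₁ := by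
    have h := hCP 1
    rw [sharpPoly_one, flatPoly_one, map_one, map_zero, one_mul, zero_mul, add_zero, hcol,
      add_zero] at h
    have e : pairingSum W (localLayerPointsOfEmb κ ι W 1) g 1 (c 1) z₁ =
        pairingSum W (localTowerPointsOfEmb κ ι W) g 1 (c 1) z := by
      rw [pairingSum_def, pairingSum_def]
      refine Finset.sum_congr rfl fun j _ ↦ ?_
      rw [evalOn_of_mem W _ z₁ (hmem1 j), evalOn_of_mem W _ z (hle 1 (hmem1 j)), hz₁]
    rw [e]
    exact h
  -- `P_{1,c_0}(z|_{E(K_1·K_v)}) = 0`: the orbit of `c_0` lies in the bottom layer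
  have hmem0 : ∀ j : ℕ, g ^ j • c 0 ∈ localLayerPointsOfEmb κ ι W 0 := fun j ↦
    smul_mem_localLayerPointsOfEmb κ ι W 0 _ (hc 0)
  have hP0 : toIwasawa p (cyclotomicOmega p 1) ∣
      pairingSum W (localLayerPointsOfEmb κ ι W 1) g 1 (c (1 - 1)) z₁ := by
    have e : pairingSum W (localLayerPointsOfEmb κ ι W 1) g 1 (c (1 - 1)) z₁ = 0 := by
      rw [pairingSum_def]
      refine Finset.sum_eq_zero fun j _ ↦ ?_
      have hj1 : g ^ j • c 0 ∈ localLayerPointsOfEmb κ ι W 1 :=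
        localLayerPointsOfEmb_mono κ ι W zero_le_one (hmem0 j)
      rw [Nat.sub_self, evalOn_of_mem W _ z₁ hj1, hz₁, h0 _ (hmem0 j), map_zero, zero_mul]
    rw [e]
    exact dvd_zero _
  -- generation clause of Thm. 2.2 at level `1`
  have hz0 : z₁ = 0 := hgen1 1 le_rfl z₁ hP1 hP0
  rw [← hz₁ x hx, hz0, AddMonoidHom.zero_apply]

end Local

/-! ## §2. The layer-`n` control map lands in `Sel^•(E/K_∞)` when `Ker Col^•` kills `E(K_n·K_v)` -/

section Landing

variable {K : Type u} [Field K] [NumberField K] (W : WeierstrassCurve K) {p : ℕ} [Fact p.Prime]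
  (κ : ZpExtension K p) (v : HeightOneSpectrum (𝓞 K))

/-- The layer subgroups `Gal(K̄/K_n)` are compact (open, hence closed, in the compact `Γ_K`).
[folklore] -/
private theorem compactSpace_layerSubgroup (n : ℕ) : CompactSpace (κ.layerSubgroup n) := by
  haveI : CompactSpace (Field.absoluteGaloisGroup K) := compactSpace_absoluteGaloisGroup K
  exact isCompact_iff_compactSpace.mp
    (Subgroup.isClosed_of_isOpen _ (κ.isOpen_layerSubgroup n)).isCompact

/-- **A class over `K_n` with the classical local condition at `v` satisfies Sprung's `•`-condition at
`𝔭` after restriction to `K_∞`, provided `Ker Col^•` kills `E(K_n·K_v)`** (the layer-`n` form of the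
tree's `Sprung2024.layerToInfty_mem_sharpFlatLocalKummerOverOfEmb_of_mem_localKerOver`, same proof with
`0 ↦ n`): the classical condition over `K_n` is the Kummer condition cut out by `E(K_n·K_v)`
(`Kobayashi2003.localKerOverOfEmb_le_localKummerOverOfEmb_fixedPoints`): `y = [φ]`, `ι φ(τ) = τQ − Q`,
`x = pᵏQ ∈ E(K_n·K_v)`; restricting `φ` to `Gal(K̄/K_∞)` gives the same identity on
`Gal(K̄_v/K_∞·K_v)`, `x ∈ E(K_∞·K_v)`, and the pairing clause `z(x) ∈ pᵏℤ_p` for `z ∈ Ker Col^•` holds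
because `z(x) = 0`. [cite: Sprung2012, Def. 7.9 and Def. 7.11 (p. 1503)] [cite: Sprung2024, §5.2 p. 39]
[cite: Kobayashi2003, Def. 1.1 and §2 p. 4] [cite: GreenbergLNM1716, §2 p. 72] -/
theorem layerToInfty_mem_sharpFlatLocalKummerOverOfEmb_of_mem_localKerOver_layer (n : ℕ) {ap : ℤ}
    {g : Field.absoluteGaloisGroup (v.adicCompletion K)}
    {c : ℕ → localPoints W (v.adicCompletion K)} {col : Chroma}
    (h𝒦 : ∀ z ∈ colemanKer κ (closureEmb (K := K) (v.adicCompletion K)) W ap g c col,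
      ∀ (x : localPoints W (v.adicCompletion K))
        (hx : x ∈ localLayerPointsOfEmb κ (closureEmb (K := K) (v.adicCompletion K)) W n),
        z ⟨x, localLayerPointsOfEmb_le_localTowerPointsOfEmb κ _ W n hx⟩ = 0)
    {y : W.subgroupH1 p (κ.layerSubgroup n)}
    (hy : y ∈ W.localKerOver p (κ.layerSubgroup n) (v.adicCompletion K)) :
    W.layerToInfty κ n y ∈ sharpFlatLocalKummerOverOfEmb W p κ.kerSubgroup
        (closureEmb (K := K) (v.adicCompletion K))
        (localTowerPointsOfEmb κ (closureEmb (K := K) (v.adicCompletion K)) W)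
        (colemanKer κ (closureEmb (K := K) (v.adicCompletion K)) W ap g c col) := by
  haveI : CompactSpace (κ.layerSubgroup n) := compactSpace_layerSubgroup κ n
  change y ∈ W.localKerOverOfEmb p (κ.layerSubgroup n) (closureEmb (K := K) (v.adicCompletion K))
    at hy
  obtain ⟨φ, Q, k, rfl, hA, hQ⟩ :=
    localKerOverOfEmb_le_localKummerOverOfEmb_fixedPoints W p (κ.layerSubgroup n)
      (closureEmb (K := K) (v.adicCompletion K)) hy
  -- `p^k Q ∈ E(K_n·K_v) ⊆ E(K_∞·K_v)`
  have hA' : (p ^ k) • Q ∈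
      localTowerPointsOfEmb κ (closureEmb (K := K) (v.adicCompletion K)) W :=
    localLayerPointsOfEmb_le_localTowerPointsOfEmb κ _ W n hA
  -- restriction to `Gal(K̄/K_∞)` on cocycles
  have hres : Literature.NumberTheory.EllipticCurves.resOfLe (W.geomPrimaryTorsion p)
      (κ.kerSubgroup_le_layerSubgroup n) (oneCocycleClass _ φ) =
      oneCocycleClass _ (contOneCocycles.pullback (subgroupInclusion (κ.kerSubgroup_le_layerSubgroup n))
        (resHomOfEquivariant (subgroupInclusion (κ.kerSubgroup_le_layerSubgroup n))
          (AddMonoidHom.id (W.geomPrimaryTorsion p)) (fun _ _ ↦ rfl)) φ) :=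
    map_oneCocycleClass _ _ _ φ
  change Literature.NumberTheory.EllipticCurves.resOfLe (W.geomPrimaryTorsion p)
    (κ.kerSubgroup_le_layerSubgroup n) (oneCocycleClass _ φ) ∈ _
  rw [hres, mem_sharpFlatLocalKummerOverOfEmb_iff]
  refine ⟨_, Q, k, hA', rfl, fun z hz ↦ ?_, fun τ ↦ ?_⟩
  · rw [h𝒦 z hz _ hA]
    exact dvd_zero _
  · have key := hQ ⟨(τ : Field.absoluteGaloisGroup (v.adicCompletion K)),
      _root_.WeierstrassCurve.localSubgroup_ker_le_layer κ (v.adicCompletion K) n τ.2⟩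
    rw [contOneCocycles.pullback_apply]
    exact key

/-- **`h_n(Sel_{p^∞}(E/K_n)) ⊆ Sel^•(E/K_∞)`** (the layer-`n` control map `s_n` exists), provided
`Ker Col^•` kills `E(K_n·K_v)` at the chosen place `v` (the layer-`n` form of the tree's
`Sprung2024.layerToInfty_mem_sharpFlatSelmerInfty_of_mem_selmerLayer_zero`): the classical part is
`map_layerToInfty_selmerLayer_le_holds`; the `•`-conditions at `𝔭` and its conjugates follow from the
previous theorem applied to `conj_σ y` (`h_n ∘ conj_σ = conj_σ ∘ h_n`). For `n = 1`, `• = ♯` the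
hypothesis is §1. [cite: Sprung2012, Def. 7.11 (p. 1503)] [cite: Sprung2024, §5.2 Lemma 5.6 (p. 41), p. 39]
[cite: Kobayashi2003, Thm. 9.3] [cite: GreenbergLNM1716, §2 p. 72] -/
theorem layerToInfty_mem_sharpFlatSelmerInfty_of_mem_selmerLayer (n : ℕ) {ap : ℤ}
    {g : Field.absoluteGaloisGroup (v.adicCompletion K)}
    {c : ℕ → localPoints W (v.adicCompletion K)} {col : Chroma}
    (h𝒦 : ∀ z ∈ colemanKer κ (closureEmb (K := K) (v.adicCompletion K)) W ap g c col,
      ∀ (x : localPoints W (v.adicCompletion K))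
        (hx : x ∈ localLayerPointsOfEmb κ (closureEmb (K := K) (v.adicCompletion K)) W n),
        z ⟨x, localLayerPointsOfEmb_le_localTowerPointsOfEmb κ _ W n hx⟩ = 0)
    {y : W.subgroupH1 p (κ.layerSubgroup n)} (hy : y ∈ W.selmerLayer κ n) :
    W.layerToInfty κ n y ∈
      sharpFlatSelmerInfty W κ (closureEmb (K := K) (v.adicCompletion K)) ap g c col := by
  rw [mem_sharpFlatSelmerInfty_iff]
  refine ⟨W.map_layerToInfty_selmerLayer_le_holds κ n (AddSubgroup.mem_map_of_mem _ hy), fun σ ↦ ?_⟩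
  rw [← W.layerToInfty_conjH1 κ σ y]
  refine layerToInfty_mem_sharpFlatLocalKummerOverOfEmb_of_mem_localKerOver_layer W κ v n h𝒦 ?_
  change y ∈ W.selmerGroupOver p (κ.layerSubgroup n) at hy
  exact ((W.mem_selmerGroupOver_iff p (κ.layerSubgroup n) y).mp hy).1 v σ

end Landing

/-! ## §3. Over `ℚ` with a Honda system, first layer, colour `♯`: the hypothesis discharged -/

section Rat

variable (W : WeierstrassCurve ℚ) (p : ℕ) [Fact p.Prime]

/-- **`h_1(Sel_{p^∞}(E/ℚ_1)) ⊆ Sel♯(E/ℚ_∞)`** in the setting of Sprung 2012 Thm. 2.2 / Def. 7.11 —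
`p ≠ 2`, `p ∣ a_p`, a `ℤ_p`-extension `κ` of `ℚ`, the place `v`, a local lift `g` of a topological
generator, a Honda system `(cneg, c)`: every classical Selmer class over the first layer `ℚ_1` restricts
into Sprung's SHARP Selmer group over `ℚ_∞` (§2 at `n = 1` with §1). [cite: Sprung2012, Def. 7.2 (p. 1500),
Def. 7.11 (p. 1503), Thm. 2.2] [cite: Sprung2024, §5.2 p. 39] [cite: GreenbergLNM1716, §2 p. 72] -/
theorem rat_layerToInfty_one_mem_sharpSelmerInfty (hp2 : p ≠ 2) {ap : ℤ} (hap : (p : ℤ) ∣ ap)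
    {κ : ZpExtension ℚ p} {v : HeightOneSpectrum (𝓞 ℚ)}
    {g : Field.absoluteGaloisGroup (v.adicCompletion ℚ)}
    (hg : κ.IsTopGenerator (resGalOfEmb (closureEmb (K := ℚ) (v.adicCompletion ℚ)) g))
    {cneg : localPoints W (v.adicCompletion ℚ)} {c : ℕ → localPoints W (v.adicCompletion ℚ)}
    (hH : IsHondaSystem κ (closureEmb (K := ℚ) (v.adicCompletion ℚ)) W ap g cneg c)
    {y : W.subgroupH1 p (κ.layerSubgroup 1)} (hy : y ∈ W.selmerLayer κ 1) :
    W.layerToInfty κ 1 y ∈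
      sharpFlatSelmerInfty W κ (closureEmb (K := ℚ) (v.adicCompletion ℚ)) ap g c Chroma.sharp :=
  layerToInfty_mem_sharpFlatSelmerInfty_of_mem_selmerLayer W κ v 1
    (fun _ hz _ hx ↦ colemanKer_sharp_apply_eq_zero_of_mem_localLayerPointsOfEmb_one κ
      (closureEmb (K := ℚ) (v.adicCompletion ℚ)) W hp2 hap hg hH hz hx) hy

end Rat

end Summit.BirchSwinnertonDyer.BirchSwinnertonDyer.Theorems.ChromaticCommonZeros

end
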